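import Summits.QuantumFields.YangMills.Theorems.UnitScaleTiltProp7BlockProfileTubeSums
import Summits.QuantumFields.YangMills.Theorems.UnitScaleTiltProp7QkFramedFlatCubeGauge
import Summits.QuantumFields.YangMills.Theorems.UnitScaleTiltProp7CmapTwSReadSet
import Summits.QuantumFields.YangMills.Theorems.UnitScaleTiltProp7QkLocalGaugeComparison
import Summits.QuantumFields.YangMills.Theorems.UnitScaleTiltProp7SymAvgTwSymDefs
import Summits.QuantumFields.YangMills.Theorems.UnitScaleTiltProp7TubeStrSubStairLineIter
import Summits.QuantumFields.YangMills.Theorems.UnitScaleTiltProp7BlockDistanceWeights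
import Summits.QuantumFields.YangMills.Theorems.UnitScaleTiltProp7TowerClosenessGeometric
import Summits.QuantumFields.YangMills.Theorems.UnitScaleTiltProp7CoarseFineKernelRows
import HarnessLib

/-!
# Route `UnitScaleTilt`, crux K1 «MinimiserStabilityRegPr» (stmt-QuantumFields-19200), EX face — K-storey (px12 g16 LOCATE-K137), pen (K1b-a) (px13 g15; LOCATE #43 §6 (F2b)) —
# **ONE TRANSPORTED BUMP: its framed-flat readback EXACTLY, its curved readback up to the ENGINE's error, and its read-set locality**

Cell `ym3-torus` (HUMAN RULING D-0037; rung R3 = SU(2) YM₃ on T³ — NOT d = 4, NOT infinite volume, NOT a mass gap, NOT Clay).  Width seat `ym3-torus-px13` (gen 15).  THEOREMS ONLY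
(0 `def`, 0 `sorry`); `--supports stmt-QuantumFields-19200 --as helper`; count-neutral; nothing of Bałaban's asserted.

THE OBJECTS (all inline; `k = K − n`, `ℓ = L^k`, `P = F.P K`).  For a coarse bond `ŷ : PBond P k` (the image `bondShift y` of `y : PBond (F.P n) 0`): the CORNER `c(ŷ) := fibreSite 0 k ŷ.src 0`,
the CUBE GAUGE `σ₀ := axialT W c(ŷ)` (✓`Prop7LODCubeGaugeFamily`), the (iv) FRAME `Φ(z) := axialT (unitsField (toUField W)) c(z) (embIter k z)` and the framed-flat frame field
`w(c′) := Φ(ĉ′.src)⁻¹·(σ₀(c(ĉ′.src))♭)⁻¹` of ✓`Prop7QkLocalGaugeComparison.normSq_Qk_sub_framed_Qk_one_le`; the SEPARABLE BLOCK PROFILE `ψ(b) := p(off_{b.dir} b.src)·Π_{ν ≠ b.dir} τ(off_ν b.src)`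
(`off_ν x = x_ν mod ℓ`; generic one-dimensional weights `p τ : ℕ → ℝ` — the consumer takes ✓`Prop7SkewBumpProfile`'s skew `p` and the parabola `τ`); the TRANSPORTED BUMP of `ŷ` with value `V`:
`A_ŷ(b) := [B^k(b.src) = ŷ.src ∧ b.dir = ŷ.dir]·ψ(b) • Ad_{(σ₀(b.src)♭)⁻¹} V` (so that `Ad_{σ₀(b.src)♭} A_ŷ(b) = X_ŷ(b) := […]·ψ(b) • V`, the FLAT bump).

WHAT IS PROVED (ns `…Theorems.Prop7TransportedBumpFlatRow`).
* §1 `pbond_eq_iff`, `conjR_ite`, ★`gauge_bump_eq` (`σ₀(b₋)·A_ŷ(b)·σ₀(b₋)⋆ = X_ŷ(b)`), `frameField_mem_U1` (✓`frame_mem_U1`).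
* §2 ★★ `eta_smul_conjR_QTwS_one_bump_apply` (+ its gauged twin ★★`eta_smul_conjR_QTwS_one_gauged_bump_apply`) — THE FRAMED-FLAT READBACK OF ONE BUMP, EXACTLY: for every coarse `c′`,
  `η • Ad_{w(c′)}(QTwS 1 X_ŷ c′) = [ĉ′ = ŷ]·(OWN·T^{d−1}∕(L^{d+1})^k) • Ad_{Φ(ŷ.src)⁻¹} V + [ĉ′.tgt = ŷ.src ∧ ĉ′.dir = ŷ.dir]·(SPILL·T^{d−1}∕(L^{d+1})^k) • Ad_{w(c′)} V`,
  `OWN = Σ_{s<ℓ}(s+1)p(s)`, `SPILL = Σ_{s<ℓ}(ℓ−1−s)p(s)`, `T = Σ_{a<ℓ}τ(a)` (✓`QTwS_one_apply` ∘ ✓`sum_tube_eq_smul_bondAvgIter` ∘ ✓`Prop7BlockProfileTubeSums.sum_tube_blockProfile` ∘ ✓`axialT_self`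
  ∘ `ηL^k = 1` ✓`pow_mul_eta_eq_one`): the own coarse bond reads the bump with the tent mass `OWN`, the backward neighbour `ŷ − e_μ` with `SPILL`, nobody else.
* §3 ★★ `normSq_Qk_bump_sub_flat_le` — THE ENGINE ✓`Prop7QkFramedFlatCubeGauge.normSq_Qk_sub_framed_Qk_one_le_cubeGauge` AT THE BLOCK CORNER (`R₀ = d(ℓ−1)`, ✓`tdist_le_of_iterBlockOf_eq`):
  `‖Q_k(W)(toL2 A_ŷ) − η•toL2B(c′ ↦ Ad_{w(c′)}(QTwS 1 X_ŷ c′))‖² ≤ 4(3·10¹⁰L¹⁰ε₀² + 192(ℓ·2a₀(d(ℓ−1) + 7ℓ))²)·(cB∕(c₀ℓ^d))·‖toL2 A_ŷ‖²` at `RegPr F n K ε₀ W` + the two windows +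
  no-wrap `2(d(ℓ−1) + 8ℓ + 1) ≤ sitesPerDir 0`; ★ `symm_Qk_bump_apply_eq_zero_of_not_read` ∕ ★ `flat_bump_apply_eq_zero_of_not_read` — both readbacks VANISH at `c′` unless `ŷ.src ∈ {ĉ′.src, ĉ′.tgt}`
  (✓`QTwS_apply_eq_zero_of_vanish_on_reads`; §2).
HONEST SCOPE.  One bump; the interpolant `E = Σ_ŷ toL2 A_ŷ`, rows (a)∕(s1)∕(s2), (K1b), K137, EX and the crux are NOT proved here (F2c∕F3).

References: T. Bałaban, CMP **95** (1984) 17–40 [Balaban1984PropagatorsI] ((1.18) p.20); CMP **98** (1985) 17–51 [Balaban1985Averaging] ((18)–(20) p.21, (125)–(127) p.36, Prop. 4 (134)–(135) p.38);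
CMP **99** (1985) 389–434 [Balaban1985BackgroundPropagators] ((3.13)–(3.16) p.393).
-/

set_option autoImplicit false

noncomputable section

open scoped BigOperators Matrix.Norms.L2Operator Matrix

namespace Summit.QuantumFields.YangMills.Theorems.Prop7TransportedBumpFlatRow

open Literature.MathematicalPhysics.QuantumFieldTheory.Balaban1983to89
open Literature.MathematicalPhysics.QuantumFieldTheory.Balaban1983to89.T3ContinuumYM3Torus
open Finset T4Continuum BlockAveraging LatticeFieldCalculus B1RG242Torus
open B5Eq118OneStroke (iterBlockOf)
open B7Prop1Explicit (U1)
open B7Eq78Linearization (conjR conjR_apply conjR_add conjR_smul conjR_smul_real)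
open B8Ineq132 (conjR_conjR one_conjR)
open B10Eq27TorusAxialLog (axialT axialT_self unitsField toUField suIncl)
open B11Eq103H1Complex (BondL2K)
open B15DeterminingSets (embIter)
open T3LevelShift (bondShift)
open T3PrintedRegularOrbits (sites_eq)
open T3PrintedRegularMinimiser (RegPr)
open T3RegularMinimiser (regThreshold regThreshold_pos)
open T3SectALandauChart (eta eta_pos)
open Summit.QuantumFields.YangMills.Theorems.Prop7SectET3HilbertLetters (toL2 toL2B)
open Summit.QuantumFields.YangMills.Theorems.Prop7SectET3CurvedPropagators (Qk)
open Summit.QuantumFields.YangMills.Theorems.Prop7SymAvgTwSym (QTwS QTwS_one_apply pow_mul_eta_eq_one)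
open Summit.QuantumFields.YangMills.Theorems.Prop7TubeStrSubStairLineIter (sum_tube_eq_smul_bondAvgIter)
open Summit.QuantumFields.YangMills.Theorems.Prop7TubeComparisonRowFlat (iterate_shift_eq_runSite)
open Summit.QuantumFields.YangMills.Theorems.Prop7CombGauge (iterBlockOf_fibreSite)
open Summit.QuantumFields.YangMills.Theorems.Prop7FlatHolonomy (sitesPerDir_zero_eq_mul_pow)
open Summit.QuantumFields.YangMills.Theorems.Prop7BlockDistanceWeights (tdist_le_of_iterBlockOf_eq)
open Summit.QuantumFields.YangMills.Theorems.Prop7QTwSLocalGaugeComparisonAllFields (conjR_toUnits_suIncl)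
open Summit.QuantumFields.YangMills.Theorems.Prop7QkLocalGaugeComparison (frame_mem_U1)
open Summit.QuantumFields.YangMills.Theorems.Prop7CmapTwSReadSet (QTwS_apply_eq_zero_of_vanish_on_reads)
open Summit.QuantumFields.YangMills.Theorems.Prop7CoarseFineKernelRows (toL2B_symm_Qk_toL2_apply)
open Summit.QuantumFields.YangMills.Theorems.Prop7QkFramedFlatCubeGauge (normSq_Qk_sub_framed_Qk_one_le_cubeGauge)
open Summit.QuantumFields.YangMills.Theorems.Prop7BlockProfileTubeSums (sum_tube_blockProfile)

/-! ## §1 Small algebra -/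

section Algebra

/-- Two positively oriented bonds agree iff their initial points and directions agree. [folklore] -/
theorem pbond_eq_iff {P : Params} {j : ℕ} (b b' : PBond P j) : b = b' ↔ b.src = b'.src ∧ b.dir = b'.dir := by
  cases b; cases b'; simp

/-- `Ad_u` of an indicator: `Ad_u(if c then X else 0) = if c then Ad_u X else 0`. [folklore] -/
theorem conjR_ite {𝔸 : Type*} [NormedRing 𝔸] (u : 𝔸ˣ) (c : Prop) [Decidable c] (X : 𝔸) :
    conjR u (if c then X else 0) = if c then conjR u X else 0 := by
  split_ifs with hc
  · rfl
  · rw [conjR_apply, mul_zero, zero_mul]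

end Algebra

/-! ## §2 One bump: the gauged bump is the flat bump; the framed-flat readback exactly -/

section Bump

variable (F : T3Family) (n K : ℕ) (h : n ≤ K) (c₀ cB : ℝ) [Fact (0 < c₀)] [Fact (0 < cB)]

/-- ★ **THE CUBE GAUGE UNDRESSES THE TRANSPORTED BUMP**: with `σ₀ := axialT W c(ŷ)`, `σ₀(b₋)·A_ŷ(b)·σ₀(b₋)⋆ = X_ŷ(b)` for every fine bond `b` (`Ad_{g♭}∘Ad_{(g♭)⁻¹} = id`,
✓`conjR_toUnits_suIncl`). [cite: Balaban1985Averaging, (8) p.19, (19) p.21] -/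
theorem gauge_bump_eq (W : GaugeField (F.P K) 0 (Matrix.specialUnitaryGroup (Fin 2) ℂ)) (p τ : ℕ → ℝ) (ŷ : PBond (F.P K) (K - n)) (V : Matrix (Fin 2) (Fin 2) ℂ) :
    (fun b : PBond (F.P K) 0 =>
        (((axialT W (Site.fibreSite 0 (K - n) ŷ.src fun _ => (⟨0, pow_pos (F.P K).L_pos (K - n)⟩ : Fin ((F.P K).L ^ (K - n))))) b.src : Matrix.specialUnitaryGroup (Fin 2) ℂ) : Matrix (Fin 2) (Fin 2) ℂ)
          * (if iterBlockOf (K - n) b.src = ŷ.src ∧ b.dir = ŷ.dir then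
              (p ((b.src b.dir).val % (F.P K).L ^ (K - n)) * ∏ ν ∈ univ.erase b.dir, τ ((b.src ν).val % (F.P K).L ^ (K - n)))
                • conjR (Unitary.toUnits (suIncl ((axialT W (Site.fibreSite 0 (K - n) ŷ.src fun _ => (⟨0, pow_pos (F.P K).L_pos (K - n)⟩ : Fin ((F.P K).L ^ (K - n))))) b.src)))⁻¹ V
            else 0)
          * star (((axialT W (Site.fibreSite 0 (K - n) ŷ.src fun _ => (⟨0, pow_pos (F.P K).L_pos (K - n)⟩ : Fin ((F.P K).L ^ (K - n))))) b.src : Matrix.specialUnitaryGroup (Fin 2) ℂ) : Matrix (Fin 2) (Fin 2) ℂ))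
      = fun b => if iterBlockOf (K - n) b.src = ŷ.src ∧ b.dir = ŷ.dir then
          (p ((b.src b.dir).val % (F.P K).L ^ (K - n)) * ∏ ν ∈ univ.erase b.dir, τ ((b.src ν).val % (F.P K).L ^ (K - n))) • V else 0 := by
  funext b
  by_cases hb : iterBlockOf (K - n) b.src = ŷ.src ∧ b.dir = ŷ.dir
  · rw [if_pos hb, if_pos hb, Matrix.mul_smul, Matrix.smul_mul, ← conjR_toUnits_suIncl, conjR_conjR, mul_inv_cancel, one_conjR]
  · rw [if_neg hb, if_neg hb, mul_zero, zero_mul]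

/-- The framed-flat frame field `w(c′) = Φ(ĉ′.src)⁻¹·(σ₀(c(ĉ′.src))♭)⁻¹` of the bump's cube gauge is `U1`-valued (✓`frame_mem_U1`). [cite: Balaban1985Averaging, (19) p.21] -/
theorem frameField_mem_U1 (W : GaugeField (F.P K) 0 (Matrix.specialUnitaryGroup (Fin 2) ℂ)) (ŷ : PBond (F.P K) (K - n)) (c' : PBond (F.P n) 0) :
    ((axialT (unitsField (toUField W)) (Site.fibreSite 0 (K - n) (bondShift (sites_eq F n K h) c').src fun _ => (⟨0, pow_pos (F.P K).L_pos (K - n)⟩ : Fin ((F.P K).L ^ (K - n)))) (embIter (K - n) (bondShift (sites_eq F n K h) c').src))⁻¹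
        * (Unitary.toUnits (suIncl ((axialT W (Site.fibreSite 0 (K - n) ŷ.src fun _ => (⟨0, pow_pos (F.P K).L_pos (K - n)⟩ : Fin ((F.P K).L ^ (K - n))))) (Site.fibreSite 0 (K - n) (bondShift (sites_eq F n K h) c').src fun _ => (⟨0, pow_pos (F.P K).L_pos (K - n)⟩ : Fin ((F.P K).L ^ (K - n)))))))⁻¹)
      ∈ U1 (Matrix (Fin 2) (Fin 2) ℂ) :=
  frame_mem_U1 F n K h W (axialT W (Site.fibreSite 0 (K - n) ŷ.src fun _ => (⟨0, pow_pos (F.P K).L_pos (K - n)⟩ : Fin ((F.P K).L ^ (K - n))))) c'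

/-- ★★ **THE FRAMED-FLAT READBACK OF ONE BUMP, EXACTLY**: for the flat bump `X_ŷ(b) = [B^k b₋ = ŷ.src ∧ b.dir = ŷ.dir]·ψ(b) • V` and every coarse bond `c′`,
`η • Ad_{w(c′)}(QTwS 1 X_ŷ c′) = [ĉ′ = ŷ]·(OWN·T^{d−1}∕(L^{d+1})^k) • Ad_{Φ(ŷ.src)⁻¹}V + [ĉ′.tgt = ŷ.src ∧ ĉ′.dir = ŷ.dir]·(SPILL·T^{d−1}∕(L^{d+1})^k) • Ad_{w(c′)}V` — `QTwS 1 = L^k•bondAvgIter`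
(✓`QTwS_one_apply`), the one-stroke tube (✓`sum_tube_eq_smul_bondAvgIter`), the own∕spill split of the separable profile (✓`sum_tube_blockProfile`), `σ₀(c(ŷ)) = 1` (✓`axialT_self`), `ηL^k = 1`.
[cite: Balaban1984PropagatorsI, (1.18) p.20; Balaban1985Averaging, (125)–(127) p.36; Balaban1985BackgroundPropagators, (3.14) p.393] -/
theorem eta_smul_conjR_QTwS_one_bump_apply (W : GaugeField (F.P K) 0 (Matrix.specialUnitaryGroup (Fin 2) ℂ)) (p τ : ℕ → ℝ) (ŷ : PBond (F.P K) (K - n))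
    (V : Matrix (Fin 2) (Fin 2) ℂ) (c' : PBond (F.P n) 0) :
    ((eta F n K : ℝ) : ℂ) • conjR
        (((axialT (unitsField (toUField W)) (Site.fibreSite 0 (K - n) (bondShift (sites_eq F n K h) c').src fun _ => (⟨0, pow_pos (F.P K).L_pos (K - n)⟩ : Fin ((F.P K).L ^ (K - n)))) (embIter (K - n) (bondShift (sites_eq F n K h) c').src))⁻¹
          * (Unitary.toUnits (suIncl ((axialT W (Site.fibreSite 0 (K - n) ŷ.src fun _ => (⟨0, pow_pos (F.P K).L_pos (K - n)⟩ : Fin ((F.P K).L ^ (K - n))))) (Site.fibreSite 0 (K - n) (bondShift (sites_eq F n K h) c').src fun _ => (⟨0, pow_pos (F.P K).L_pos (K - n)⟩ : Fin ((F.P K).L ^ (K - n)))))))⁻¹))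
        (QTwS F n K h (1 : GaugeField (F.P K) 0 (Matrix.specialUnitaryGroup (Fin 2) ℂ))
          (fun b => if iterBlockOf (K - n) b.src = ŷ.src ∧ b.dir = ŷ.dir then
            (p ((b.src b.dir).val % (F.P K).L ^ (K - n)) * ∏ ν ∈ univ.erase b.dir, τ ((b.src ν).val % (F.P K).L ^ (K - n))) • V else 0) c')
      = (if bondShift (sites_eq F n K h) c' = ŷ then
            (((∑ s ∈ range ((F.P K).L ^ (K - n)), ((s : ℝ) + 1) * p s) * (∑ a ∈ range ((F.P K).L ^ (K - n)), τ a) ^ ((F.P K).d - 1))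
                * ((((F.P K).L : ℝ) ^ ((F.P K).d + 1)) ^ (K - n))⁻¹)
              • conjR ((axialT (unitsField (toUField W)) (Site.fibreSite 0 (K - n) ŷ.src fun _ => (⟨0, pow_pos (F.P K).L_pos (K - n)⟩ : Fin ((F.P K).L ^ (K - n)))) (embIter (K - n) ŷ.src)))⁻¹ V
          else 0)
        + (if (bondShift (sites_eq F n K h) c').tgt = ŷ.src ∧ (bondShift (sites_eq F n K h) c').dir = ŷ.dir then
            (((∑ s ∈ range ((F.P K).L ^ (K - n)), ((((F.P K).L ^ (K - n) : ℕ) : ℝ) - 1 - (s : ℝ)) * p s) * (∑ a ∈ range ((F.P K).L ^ (K - n)), τ a) ^ ((F.P K).d - 1))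
                * ((((F.P K).L : ℝ) ^ ((F.P K).d + 1)) ^ (K - n))⁻¹)
              • conjR
                  (((axialT (unitsField (toUField W)) (Site.fibreSite 0 (K - n) (bondShift (sites_eq F n K h) c').src fun _ => (⟨0, pow_pos (F.P K).L_pos (K - n)⟩ : Fin ((F.P K).L ^ (K - n)))) (embIter (K - n) (bondShift (sites_eq F n K h) c').src))⁻¹
                    * (Unitary.toUnits (suIncl ((axialT W (Site.fibreSite 0 (K - n) ŷ.src fun _ => (⟨0, pow_pos (F.P K).L_pos (K - n)⟩ : Fin ((F.P K).L ^ (K - n))))) (Site.fibreSite 0 (K - n) (bondShift (sites_eq F n K h) c').src fun _ => (⟨0, pow_pos (F.P K).L_pos (K - n)⟩ : Fin ((F.P K).L ^ (K - n)))))))⁻¹)) V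
          else 0) := by
  classical
  have hk : K - n ≤ (F.P K).m + (F.P K).K := by show K - n ≤ F.m + K; omega
  have hL0 : (0 : ℝ) < (F.P K).L := by exact_mod_cast (F.P K).L_pos
  have hs : ((((F.P K).L : ℝ) ^ ((F.P K).d + 1)) ^ (K - n)) ≠ 0 := by positivity
  have hc0 : ∀ u : (Matrix (Fin 2) (Fin 2) ℂ)ˣ, conjR u (0 : Matrix (Fin 2) (Fin 2) ℂ) = 0 := fun u => by rw [conjR_apply, mul_zero, zero_mul]
  -- abbreviations (`ĉ` in the printed family's letters, as the statement elaborates it)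
  set ĉ : PBond (F.P K) (K - n) := bondShift (sites_eq F n K h) c' with hĉ
  set X : PBond (F.P K) 0 → Matrix (Fin 2) (Fin 2) ℂ := fun b => if iterBlockOf (K - n) b.src = ŷ.src ∧ b.dir = ŷ.dir then
      (p ((b.src b.dir).val % (F.P K).L ^ (K - n)) * ∏ ν ∈ univ.erase b.dir, τ ((b.src ν).val % (F.P K).L ^ (K - n))) • V else 0 with hX
  set w : (Matrix (Fin 2) (Fin 2) ℂ)ˣ :=
    ((axialT (unitsField (toUField W)) (Site.fibreSite 0 (K - n) ĉ.src fun _ => (⟨0, pow_pos (F.P K).L_pos (K - n)⟩ : Fin ((F.P K).L ^ (K - n)))) (embIter (K - n) ĉ.src))⁻¹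
      * (Unitary.toUnits (suIncl ((axialT W (Site.fibreSite 0 (K - n) ŷ.src fun _ => (⟨0, pow_pos (F.P K).L_pos (K - n)⟩ : Fin ((F.P K).L ^ (K - n))))) (Site.fibreSite 0 (K - n) ĉ.src fun _ => (⟨0, pow_pos (F.P K).L_pos (K - n)⟩ : Fin ((F.P K).L ^ (K - n)))))))⁻¹) with hw
  -- the block datum of the bump
  set M : Site (F.P K) (K - n) → Matrix (Fin 2) (Fin 2) ℂ := fun z => if z = ŷ.src then V else 0 with hM
  -- Step 1: `QTwS 1 X c' = L^k • bondAvgIter X ĉ` and the one-stroke tube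
  have htube := sum_tube_eq_smul_bondAvgIter hk X ĉ
  simp only [iterate_shift_eq_runSite] at htube
  -- the scalars `η`, `L^k` as real scalars
  have hηL : eta F n K * ((F.P K).L : ℝ) ^ (K - n) = 1 := by rw [mul_comm]; exact pow_mul_eta_eq_one F
  have hcastL : ((((F.P K).L : ℕ) : ℂ) ^ (K - n)) = (((((F.P K).L : ℝ) ^ (K - n) : ℝ)) : ℂ) := by push_cast; rfl
  rw [QTwS_one_apply, ← hĉ, hcastL, Complex.coe_smul, Complex.coe_smul, conjR_smul_real, smul_smul]
  by_cases hdir : ĉ.dir = ŷ.dir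
  · -- the summand is the separable profile times the block datum
    have hterm : ∀ (r : Fin (F.P K).d → Fin ((F.P K).L ^ (K - n))) (t : ℕ),
        X ⟨runSite (Site.fibreSite 0 (K - n) ĉ.src r) ĉ.dir t, ĉ.dir⟩
          = (p (((runSite (Site.fibreSite 0 (K - n) ĉ.src r) ĉ.dir t) ĉ.dir).val % (F.P K).L ^ (K - n))
              * ∏ ν ∈ univ.erase ĉ.dir, τ (((runSite (Site.fibreSite 0 (K - n) ĉ.src r) ĉ.dir t) ν).val % (F.P K).L ^ (K - n)))
            • M (iterBlockOf (K - n) (runSite (Site.fibreSite 0 (K - n) ĉ.src r) ĉ.dir t)) := by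
      intro r t
      simp only [hX, hM, hdir, and_true, smul_ite, smul_zero]
    rw [Finset.sum_congr rfl fun r _ => Finset.sum_congr rfl fun t _ => hterm r t, sum_tube_blockProfile hk p τ M ĉ.src ĉ.dir] at htube
    have hbai : bondAvgIter (K - n) X ĉ
        = ((((F.P K).L : ℝ) ^ ((F.P K).d + 1)) ^ (K - n))⁻¹ •
          (((∑ s ∈ range ((F.P K).L ^ (K - n)), ((s : ℝ) + 1) * p s) * (∑ a ∈ range ((F.P K).L ^ (K - n)), τ a) ^ ((F.P K).d - 1)) • M ĉ.src
            + ((∑ s ∈ range ((F.P K).L ^ (K - n)), ((((F.P K).L ^ (K - n) : ℕ) : ℝ) - 1 - (s : ℝ)) * p s) * (∑ a ∈ range ((F.P K).L ^ (K - n)), τ a) ^ ((F.P K).d - 1))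
              • M (ĉ.src.shift ĉ.dir)) := by
      rw [htube, smul_smul, inv_mul_cancel₀ hs, one_smul]
    rw [hbai, smul_add, smul_smul, smul_smul, conjR_add, conjR_smul_real, conjR_smul_real, smul_add, smul_smul, smul_smul]
    -- the block datum on the two blocks read by `ĉ`
    have hsrc_of : ĉ = ŷ → M ĉ.src = V := fun h1 => by
      simp only [hM]
      exact if_pos (congrArg PBond.src h1)
    have hsrc_not : ¬ ĉ = ŷ → M ĉ.src = 0 := fun h1 => by
      simp only [hM]
      exact if_neg fun h2 => h1 ((pbond_eq_iff _ _).mpr ⟨h2, hdir⟩)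
    have htgt_of : ĉ.tgt = ŷ.src ∧ ĉ.dir = ŷ.dir → M (ĉ.src.shift ĉ.dir) = V := fun h2 => by
      simp only [hM]
      exact if_pos h2.1
    have htgt_not : ¬ (ĉ.tgt = ŷ.src ∧ ĉ.dir = ŷ.dir) → M (ĉ.src.shift ĉ.dir) = 0 := fun h2 => by
      simp only [hM]
      exact if_neg fun h3 => h2 ⟨h3, hdir⟩
    -- at `ĉ = ŷ` the gauge letter is `σ₀(c(ŷ)) = 1`, so `w = Φ(ŷ.src)⁻¹`
    have hw1 : ĉ = ŷ → w = ((axialT (unitsField (toUField W)) (Site.fibreSite 0 (K - n) ŷ.src fun _ => (⟨0, pow_pos (F.P K).L_pos (K - n)⟩ : Fin ((F.P K).L ^ (K - n)))) (embIter (K - n) ŷ.src)))⁻¹ := by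
      intro h1
      have hs : (ĉ : PBond (F.PP F.m K) (K - n)).src = ŷ.src := congrArg PBond.src h1
      rw [hw, hs, axialT_self, map_one, map_one, inv_one, mul_one]
    -- the two scalars: `η·L^k = 1`
    have hsc1 : eta F n K * ((F.P K).L : ℝ) ^ (K - n) * (((((F.P K).L : ℝ) ^ ((F.P K).d + 1)) ^ (K - n))⁻¹
          * ((∑ s ∈ range ((F.P K).L ^ (K - n)), ((s : ℝ) + 1) * p s) * (∑ a ∈ range ((F.P K).L ^ (K - n)), τ a) ^ ((F.P K).d - 1)))
        = (∑ s ∈ range ((F.P K).L ^ (K - n)), ((s : ℝ) + 1) * p s) * (∑ a ∈ range ((F.P K).L ^ (K - n)), τ a) ^ ((F.P K).d - 1)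
          * ((((F.P K).L : ℝ) ^ ((F.P K).d + 1)) ^ (K - n))⁻¹ := by
      rw [hηL]; ring
    have hsc2 : eta F n K * ((F.P K).L : ℝ) ^ (K - n) * (((((F.P K).L : ℝ) ^ ((F.P K).d + 1)) ^ (K - n))⁻¹
          * ((∑ s ∈ range ((F.P K).L ^ (K - n)), ((((F.P K).L ^ (K - n) : ℕ) : ℝ) - 1 - (s : ℝ)) * p s) * (∑ a ∈ range ((F.P K).L ^ (K - n)), τ a) ^ ((F.P K).d - 1)))
        = (∑ s ∈ range ((F.P K).L ^ (K - n)), ((((F.P K).L ^ (K - n) : ℕ) : ℝ) - 1 - (s : ℝ)) * p s) * (∑ a ∈ range ((F.P K).L ^ (K - n)), τ a) ^ ((F.P K).d - 1)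
          * ((((F.P K).L : ℝ) ^ ((F.P K).d + 1)) ^ (K - n))⁻¹ := by
      rw [hηL]; ring
    rw [hsc1, hsc2]
    split_ifs with h1 h2 h2
    · rw [hsrc_of h1, htgt_of h2, hw1 h1]
    · rw [hsrc_of h1, htgt_not h2, hw1 h1, hc0, smul_zero]
    · rw [hsrc_not h1, htgt_of h2, hc0, smul_zero]
    · rw [hsrc_not h1, htgt_not h2, hc0, smul_zero, smul_zero]
  · -- wrong direction: the tube of `ĉ` meets no bond of the bump
    have h0 : ∀ (r : Fin (F.P K).d → Fin ((F.P K).L ^ (K - n))) (t : ℕ), X ⟨runSite (Site.fibreSite 0 (K - n) ĉ.src r) ĉ.dir t, ĉ.dir⟩ = 0 := by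
      intro r t
      simp only [hX]
      rw [if_neg]
      rintro ⟨_, h2⟩
      exact hdir h2
    simp only [h0, Finset.sum_const_zero] at htube
    have hbai : bondAvgIter (K - n) X ĉ = 0 := by
      rcases smul_eq_zero.mp htube.symm with h1 | h1
      · exact absurd h1 hs
      · exact h1
    rw [hbai, hc0, smul_zero, if_neg (fun hc => hdir (by rw [hc])), if_neg (fun hc => hdir hc.2), add_zero]

/-- ★★ **THE SAME, FOR THE GAUGED TRANSPORTED BUMP** (the form the ENGINE reads): `η • Ad_{w(c′)}(QTwS 1 (σ₀A_ŷσ₀⋆) c′) = [ĉ′ = ŷ]·(OWN·T^{d−1}∕(L^{d+1})^k) • Ad_{Φ(ŷ.src)⁻¹}V +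
[ĉ′.tgt = ŷ.src ∧ ĉ′.dir = ŷ.dir]·(SPILL·T^{d−1}∕(L^{d+1})^k) • Ad_{w(c′)}V` (★`gauge_bump_eq` ∘ ★★`eta_smul_conjR_QTwS_one_bump_apply`).
[cite: Balaban1984PropagatorsI, (1.18) p.20; Balaban1985Averaging, (8) p.19, (125)–(127) p.36] -/
theorem eta_smul_conjR_QTwS_one_gauged_bump_apply (W : GaugeField (F.P K) 0 (Matrix.specialUnitaryGroup (Fin 2) ℂ)) (p τ : ℕ → ℝ) (ŷ : PBond (F.P K) (K - n))
    (V : Matrix (Fin 2) (Fin 2) ℂ) (c' : PBond (F.P n) 0) :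
    ((eta F n K : ℝ) : ℂ) • conjR
        (((axialT (unitsField (toUField W)) (Site.fibreSite 0 (K - n) (bondShift (sites_eq F n K h) c').src fun _ => (⟨0, pow_pos (F.P K).L_pos (K - n)⟩ : Fin ((F.P K).L ^ (K - n)))) (embIter (K - n) (bondShift (sites_eq F n K h) c').src))⁻¹
          * (Unitary.toUnits (suIncl ((axialT W (Site.fibreSite 0 (K - n) ŷ.src fun _ => (⟨0, pow_pos (F.P K).L_pos (K - n)⟩ : Fin ((F.P K).L ^ (K - n))))) (Site.fibreSite 0 (K - n) (bondShift (sites_eq F n K h) c').src fun _ => (⟨0, pow_pos (F.P K).L_pos (K - n)⟩ : Fin ((F.P K).L ^ (K - n)))))))⁻¹))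
        (QTwS F n K h (1 : GaugeField (F.P K) 0 (Matrix.specialUnitaryGroup (Fin 2) ℂ))
          (fun b => (((axialT W (Site.fibreSite 0 (K - n) ŷ.src fun _ => (⟨0, pow_pos (F.P K).L_pos (K - n)⟩ : Fin ((F.P K).L ^ (K - n))))) b.src : Matrix.specialUnitaryGroup (Fin 2) ℂ) : Matrix (Fin 2) (Fin 2) ℂ)
            * (if iterBlockOf (K - n) b.src = ŷ.src ∧ b.dir = ŷ.dir then
                (p ((b.src b.dir).val % (F.P K).L ^ (K - n)) * ∏ ν ∈ univ.erase b.dir, τ ((b.src ν).val % (F.P K).L ^ (K - n)))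
                  • conjR (Unitary.toUnits (suIncl ((axialT W (Site.fibreSite 0 (K - n) ŷ.src fun _ => (⟨0, pow_pos (F.P K).L_pos (K - n)⟩ : Fin ((F.P K).L ^ (K - n))))) b.src)))⁻¹ V
              else 0)
            * star (((axialT W (Site.fibreSite 0 (K - n) ŷ.src fun _ => (⟨0, pow_pos (F.P K).L_pos (K - n)⟩ : Fin ((F.P K).L ^ (K - n))))) b.src : Matrix.specialUnitaryGroup (Fin 2) ℂ) : Matrix (Fin 2) (Fin 2) ℂ)) c')
      = (if bondShift (sites_eq F n K h) c' = ŷ then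
            (((∑ s ∈ range ((F.P K).L ^ (K - n)), ((s : ℝ) + 1) * p s) * (∑ a ∈ range ((F.P K).L ^ (K - n)), τ a) ^ ((F.P K).d - 1))
                * ((((F.P K).L : ℝ) ^ ((F.P K).d + 1)) ^ (K - n))⁻¹)
              • conjR ((axialT (unitsField (toUField W)) (Site.fibreSite 0 (K - n) ŷ.src fun _ => (⟨0, pow_pos (F.P K).L_pos (K - n)⟩ : Fin ((F.P K).L ^ (K - n)))) (embIter (K - n) ŷ.src)))⁻¹ V
          else 0)
        + (if (bondShift (sites_eq F n K h) c').tgt = ŷ.src ∧ (bondShift (sites_eq F n K h) c').dir = ŷ.dir then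
            (((∑ s ∈ range ((F.P K).L ^ (K - n)), ((((F.P K).L ^ (K - n) : ℕ) : ℝ) - 1 - (s : ℝ)) * p s) * (∑ a ∈ range ((F.P K).L ^ (K - n)), τ a) ^ ((F.P K).d - 1))
                * ((((F.P K).L : ℝ) ^ ((F.P K).d + 1)) ^ (K - n))⁻¹)
              • conjR
                  (((axialT (unitsField (toUField W)) (Site.fibreSite 0 (K - n) (bondShift (sites_eq F n K h) c').src fun _ => (⟨0, pow_pos (F.P K).L_pos (K - n)⟩ : Fin ((F.P K).L ^ (K - n)))) (embIter (K - n) (bondShift (sites_eq F n K h) c').src))⁻¹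
                    * (Unitary.toUnits (suIncl ((axialT W (Site.fibreSite 0 (K - n) ŷ.src fun _ => (⟨0, pow_pos (F.P K).L_pos (K - n)⟩ : Fin ((F.P K).L ^ (K - n))))) (Site.fibreSite 0 (K - n) (bondShift (sites_eq F n K h) c').src fun _ => (⟨0, pow_pos (F.P K).L_pos (K - n)⟩ : Fin ((F.P K).L ^ (K - n)))))))⁻¹)) V
          else 0) := by
  rw [gauge_bump_eq]
  exact eta_smul_conjR_QTwS_one_bump_apply F n K h W p τ ŷ V c'

end Bump

/-! ## §3 One bump: the curved readback (the ENGINE at the block corner) and read-set locality -/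

section Curved

variable (F : T3Family) (n K : ℕ) (h : n ≤ K) (c₀ cB : ℝ) [Fact (0 < c₀)] [Fact (0 < cB)]

/-- ★★ **THE ENGINE AT THE BLOCK CORNER**: `RegPr F n K ε₀ W`, `10¹⁰L⁶ε₀ ≤ 1`, `10¹²L³ε₀ ≤ 1`, no-wrap `2(d(ℓ−1) + 8ℓ + 1) ≤ sitesPerDir 0` ⟹ for the transported bump `A_ŷ` (value `V`):
`‖Q_k(W)(toL2 A_ŷ) − η•toL2B(c′ ↦ Ad_{w(c′)}(QTwS 1 (Ad_{σ₀}A_ŷ) c′))‖² ≤ 4(3·10¹⁰L¹⁰ε₀² + 192(ℓ·2a₀(d(ℓ−1) + 7ℓ))²)·(cB∕(c₀ℓ^d))·‖toL2 A_ŷ‖²` — ✓`normSq_Qk_sub_framed_Qk_one_le_cubeGauge` with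
centre `c(ŷ)`, `R₀ = d(ℓ−1)` (a bond of the bump starts in the block of the corner: ✓`tdist_le_of_iterBlockOf_eq`). [cite: Balaban1985BackgroundPropagators, (3.13)–(3.16) p.393, Thm 3.11 p.416;
Balaban1985Averaging, Prop. 4 (134)–(135) p.38] -/
theorem normSq_Qk_bump_sub_flat_le {ε₀ : ℝ} (hε₀ : 0 < ε₀) (hε : 10 ^ 10 * (F.L : ℝ) ^ 6 * ε₀ ≤ 1) (hε12 : 10 ^ 12 * (F.L : ℝ) ^ 3 * ε₀ ≤ 1)
    (W : GaugeField (F.P K) 0 (Matrix.specialUnitaryGroup (Fin 2) ℂ)) (hreg : RegPr F n K ε₀ W) (p τ : ℕ → ℝ) (ŷ : PBond (F.P K) (K - n)) (V : Matrix (Fin 2) (Fin 2) ℂ)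
    (hwrap : 2 * ((F.P K).d * ((F.P K).L ^ (K - n) - 1) + 8 * (F.P K).L ^ (K - n) + 1) ≤ (F.P K).sitesPerDir 0) :
    ‖Qk F n K h c₀ cB W (toL2 F K c₀ (fun b : PBond (F.P K) 0 => if iterBlockOf (K - n) b.src = ŷ.src ∧ b.dir = ŷ.dir then
          (p ((b.src b.dir).val % (F.P K).L ^ (K - n)) * ∏ ν ∈ univ.erase b.dir, τ ((b.src ν).val % (F.P K).L ^ (K - n)))
            • conjR (Unitary.toUnits (suIncl ((axialT W (Site.fibreSite 0 (K - n) ŷ.src fun _ => (⟨0, pow_pos (F.P K).L_pos (K - n)⟩ : Fin ((F.P K).L ^ (K - n))))) b.src)))⁻¹ V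
          else 0))
        - ((eta F n K : ℝ) : ℂ) • toL2B F n cB (fun c' => conjR
            (((axialT (unitsField (toUField W)) (Site.fibreSite 0 (K - n) (bondShift (sites_eq F n K h) c').src fun _ => (⟨0, pow_pos (F.P K).L_pos (K - n)⟩ : Fin ((F.P K).L ^ (K - n)))) (embIter (K - n) (bondShift (sites_eq F n K h) c').src))⁻¹
              * (Unitary.toUnits (suIncl ((axialT W (Site.fibreSite 0 (K - n) ŷ.src fun _ => (⟨0, pow_pos (F.P K).L_pos (K - n)⟩ : Fin ((F.P K).L ^ (K - n))))) (Site.fibreSite 0 (K - n) (bondShift (sites_eq F n K h) c').src fun _ => (⟨0, pow_pos (F.P K).L_pos (K - n)⟩ : Fin ((F.P K).L ^ (K - n)))))))⁻¹))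
            (QTwS F n K h (1 : GaugeField (F.P K) 0 (Matrix.specialUnitaryGroup (Fin 2) ℂ))
              (fun b => (((axialT W (Site.fibreSite 0 (K - n) ŷ.src fun _ => (⟨0, pow_pos (F.P K).L_pos (K - n)⟩ : Fin ((F.P K).L ^ (K - n))))) b.src : Matrix.specialUnitaryGroup (Fin 2) ℂ) : Matrix (Fin 2) (Fin 2) ℂ)
                * (if iterBlockOf (K - n) b.src = ŷ.src ∧ b.dir = ŷ.dir then
                    (p ((b.src b.dir).val % (F.P K).L ^ (K - n)) * ∏ ν ∈ univ.erase b.dir, τ ((b.src ν).val % (F.P K).L ^ (K - n)))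
                      • conjR (Unitary.toUnits (suIncl ((axialT W (Site.fibreSite 0 (K - n) ŷ.src fun _ => (⟨0, pow_pos (F.P K).L_pos (K - n)⟩ : Fin ((F.P K).L ^ (K - n))))) b.src)))⁻¹ V
                  else 0)
                * star (((axialT W (Site.fibreSite 0 (K - n) ŷ.src fun _ => (⟨0, pow_pos (F.P K).L_pos (K - n)⟩ : Fin ((F.P K).L ^ (K - n))))) b.src : Matrix.specialUnitaryGroup (Fin 2) ℂ) : Matrix (Fin 2) (Fin 2) ℂ)) c'))‖ ^ 2
      ≤ 4 * (3 * 10 ^ 10 * (F.L : ℝ) ^ 10 * ε₀ ^ 2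
            + 192 * ((F.L : ℝ) ^ (K - n) * (2 * regThreshold F n K ε₀ * (((((F.P K).d * ((F.P K).L ^ (K - n) - 1) : ℕ)) : ℝ) + 7 * (F.L : ℝ) ^ (K - n)))) ^ 2)
          * (cB / (c₀ * ((F.L : ℝ) ^ (K - n)) ^ (F.P K).d))
          * ‖toL2 F K c₀ (fun b : PBond (F.P K) 0 => if iterBlockOf (K - n) b.src = ŷ.src ∧ b.dir = ŷ.dir then
              (p ((b.src b.dir).val % (F.P K).L ^ (K - n)) * ∏ ν ∈ univ.erase b.dir, τ ((b.src ν).val % (F.P K).L ^ (K - n)))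
                • conjR (Unitary.toUnits (suIncl ((axialT W (Site.fibreSite 0 (K - n) ŷ.src fun _ => (⟨0, pow_pos (F.P K).L_pos (K - n)⟩ : Fin ((F.P K).L ^ (K - n))))) b.src)))⁻¹ V
              else 0)‖ ^ 2 := by
  have hk : K - n ≤ (F.P K).m + (F.P K).K := by show K - n ≤ F.m + K; omega
  have hP : (F.P K).sitesPerDir 0 = (F.P K).L ^ (K - n) * (F.P K).sitesPerDir (K - n) := by rw [sitesPerDir_zero_eq_mul_pow hk, mul_comm]
  refine normSq_Qk_sub_framed_Qk_one_le_cubeGauge F n K h c₀ cB hε₀ hε hε12 W hreg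
    (Site.fibreSite 0 (K - n) ŷ.src fun _ => (⟨0, pow_pos (F.P K).L_pos (K - n)⟩ : Fin ((F.P K).L ^ (K - n)))) _ (fun b hb => ?_) hwrap
  have hcond : iterBlockOf (K - n) b.src = ŷ.src ∧ b.dir = ŷ.dir := by
    by_contra hc
    exact hb (if_neg hc)
  exact tdist_le_of_iterBlockOf_eq hk (by rw [iterBlockOf_fibreSite hk hP, hcond.1])

omit [Fact (0 < c₀)] [Fact (0 < cB)] in
/-- ★ **THE CURVED READBACK OF ONE BUMP VANISHES OFF ITS TWO READERS**: `RegPr`, `10¹²L³ε₀ ≤ 1`, `ŷ.src ∉ {ĉ′.src, ĉ′.tgt}` ⟹ `toL2B⁻¹(Q_k(W)(toL2 A_ŷ))(c′) = 0` (the bump vanishes on the read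
set of `c′`, ✓`QTwS_apply_eq_zero_of_vanish_on_reads`). [cite: Balaban1985BackgroundPropagators, (3.13)–(3.14) p.393; Balaban1985Averaging, (110) p.34] -/
theorem symm_Qk_bump_apply_eq_zero_of_not_read {ε₀ : ℝ} (hε₀ : 0 < ε₀) (hε12 : 10 ^ 12 * (F.L : ℝ) ^ 3 * ε₀ ≤ 1)
    (W : GaugeField (F.P K) 0 (Matrix.specialUnitaryGroup (Fin 2) ℂ)) (hreg : RegPr F n K ε₀ W) (p τ : ℕ → ℝ) (ŷ : PBond (F.P K) (K - n)) (V : Matrix (Fin 2) (Fin 2) ℂ)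
    (c' : PBond (F.P n) 0) (hfar : ¬ (ŷ.src = (bondShift (sites_eq F n K h) c').src ∨ ŷ.src = (bondShift (sites_eq F n K h) c').tgt)) :
    (toL2B F n cB).symm (Qk F n K h c₀ cB W (toL2 F K c₀ (fun b : PBond (F.P K) 0 => if iterBlockOf (K - n) b.src = ŷ.src ∧ b.dir = ŷ.dir then
          (p ((b.src b.dir).val % (F.P K).L ^ (K - n)) * ∏ ν ∈ univ.erase b.dir, τ ((b.src ν).val % (F.P K).L ^ (K - n)))
            • conjR (Unitary.toUnits (suIncl ((axialT W (Site.fibreSite 0 (K - n) ŷ.src fun _ => (⟨0, pow_pos (F.P K).L_pos (K - n)⟩ : Fin ((F.P K).L ^ (K - n))))) b.src)))⁻¹ V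
          else 0))) c' = 0 := by
  classical
  have hL0 : (0 : ℝ) < F.L := by exact_mod_cast lt_trans zero_lt_one F.hL.2
  set e : ℝ := (10 ^ 9 * (F.L : ℝ) ^ 2)⁻¹ with he_def
  have he : 0 < e := by rw [he_def]; positivity
  have hWe : 10 ^ 9 * (F.L : ℝ) ^ 2 * e ≤ 1 := by rw [he_def, mul_inv_cancel₀ (by positivity)]
  rw [toL2B_symm_Qk_toL2_apply, QTwS_apply_eq_zero_of_vanish_on_reads F n K h hε₀ he hWe hε12 W hreg _ c' fun b hbs _ => ?_, smul_zero]
  by_cases hc : iterBlockOf (K - n) b.src = ŷ.src ∧ b.dir = ŷ.dir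
  · refine absurd ?_ hfar
    rcases hbs with h1 | h1
    · exact Or.inl (by rw [← hc.1, h1])
    · exact Or.inr (by rw [← hc.1, h1])
  · exact if_neg hc

/-- ★ **THE FRAMED-FLAT READBACK OF ONE BUMP VANISHES OFF ITS TWO READERS**: `ŷ.src ∉ {ĉ′.src, ĉ′.tgt}` ⟹ `η • Ad_{w(c′)}(QTwS 1 X_ŷ c′) = 0` (§2: both indicators fail).
[cite: Balaban1984PropagatorsI, (1.18) p.20] -/
theorem flat_bump_apply_eq_zero_of_not_read (W : GaugeField (F.P K) 0 (Matrix.specialUnitaryGroup (Fin 2) ℂ)) (p τ : ℕ → ℝ) (ŷ : PBond (F.P K) (K - n))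
    (V : Matrix (Fin 2) (Fin 2) ℂ) (c' : PBond (F.P n) 0) (hfar : ¬ (ŷ.src = (bondShift (sites_eq F n K h) c').src ∨ ŷ.src = (bondShift (sites_eq F n K h) c').tgt)) :
    ((eta F n K : ℝ) : ℂ) • conjR
        (((axialT (unitsField (toUField W)) (Site.fibreSite 0 (K - n) (bondShift (sites_eq F n K h) c').src fun _ => (⟨0, pow_pos (F.P K).L_pos (K - n)⟩ : Fin ((F.P K).L ^ (K - n)))) (embIter (K - n) (bondShift (sites_eq F n K h) c').src))⁻¹
          * (Unitary.toUnits (suIncl ((axialT W (Site.fibreSite 0 (K - n) ŷ.src fun _ => (⟨0, pow_pos (F.P K).L_pos (K - n)⟩ : Fin ((F.P K).L ^ (K - n))))) (Site.fibreSite 0 (K - n) (bondShift (sites_eq F n K h) c').src fun _ => (⟨0, pow_pos (F.P K).L_pos (K - n)⟩ : Fin ((F.P K).L ^ (K - n)))))))⁻¹))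
        (QTwS F n K h (1 : GaugeField (F.P K) 0 (Matrix.specialUnitaryGroup (Fin 2) ℂ))
          (fun b => if iterBlockOf (K - n) b.src = ŷ.src ∧ b.dir = ŷ.dir then
            (p ((b.src b.dir).val % (F.P K).L ^ (K - n)) * ∏ ν ∈ univ.erase b.dir, τ ((b.src ν).val % (F.P K).L ^ (K - n))) • V else 0) c') = 0 := by
  rw [eta_smul_conjR_QTwS_one_bump_apply, if_neg, if_neg, add_zero]
  · rintro ⟨h1, _⟩
    exact hfar (Or.inr h1.symm)
  · intro hc
    exact hfar (Or.inl (by rw [← hc]))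

end Curved

end Summit.QuantumFields.YangMills.Theorems.Prop7TransportedBumpFlatRow

end
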